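import Mathlib
import Literature.Probability.Moments.HoeffdingCounting

/-!
# `SnSubsetDichotomy.PolynomialSlack`, line `transport-split-hull`: `stub_balancedSplit`

The EXCHANGEABILITY step of the line, in pure form (crux `stmt-MatrixMultiplication-8306`,
skeleton `Cruxes/PolynomialSlack/TransportSplitHull`, stub `stub_balancedSplit`): for a finite
family `(f_i)_{i ∈ ι}` of test functions on a finite set `T` with `0 ≤ f_i ≤ M_i` on `T`, if
`2|ι|·e^{-2δ²|T|} < 1` then ONE subset `T₁ ⊆ T` balances all of them simultaneously,
`|Σ_{T₁} f_i − ½ Σ_T f_i| < δ·M_i·|T|` for every `i`.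

Proof (probabilistic method in counting form). A subset `T₁ ⊆ T` is a point `y` of the product
space `↥T → Bool` (`2^{|T|}` points), and
`Σ_{T₁(y)} f_i − ½ Σ_T f_i = Σ_{t : ↥T} D_i(t, y t)` with `D_i(t, b) = ± f_i(t)/2`, a sum of
independent mean-zero coordinates bounded by `M_i/2`. The tree's counting Hoeffding inequality
`Literature.Probability.Moments.hoeffding_count_pi` at threshold `λ = δ M_i |T|` bounds each of the
`2|ι|` one-sided bad events `{±Σ D_i ≥ λ}` by `e^{-2δ²|T|}·2^{|T|}` points
(`card_filter_signedHalfSum_le`); by the union bound the bad points are `< 2^{|T|}`, so a good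
`y` exists, and for it `|Σ D_i| < λ` for every `i`. The degenerate case `T = ∅` forces `ι = ∅`.
-/

namespace Summit.MatrixMultiplication.MatrixMultiplication.Theorems.PolynomialSlack

open scoped BigOperators
open Finset

set_option linter.dupNamespace false in -- deliberate `Summit.<S>.<P>` duplicate
/-- **One-sided Hoeffding tail for a signed half-sum.** On the product space `β → Bool` over a
finite coordinate set `β` of size `n > 0`, if every coordinate summand `F t : Bool → ℝ` has mean
zero (`F t true + F t false = 0`) and `|F t b| ≤ K/2`, then the event `{y : δ K n ≤ Σ_t F t (y t)}`
has at most `e^{-2δ²n}·2^n` points (Hoeffding's inequality, counting form, specialised to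
`c_t = K/2`, `Σ c_t² = nK²/4`, `λ = δ K n`). [folklore] -/
theorem card_filter_signedHalfSum_le {β : Type*} [Fintype β] [DecidableEq β]
    (F : β → Bool → ℝ) {K δ : ℝ} {n : ℕ} (hn : Fintype.card β = n) (hnpos : 0 < n)
    (hδ : 0 ≤ δ) (hK : 0 < K) (hF0 : ∀ t, F t true + F t false = 0)
    (hFK : ∀ t b, |F t b| ≤ K / 2) :
    ((Finset.univ.filter fun y : β → Bool => δ * K * n ≤ ∑ t, F t (y t)).card : ℝ) ≤
      Real.exp (-(2 * δ ^ 2 * n)) * 2 ^ n := by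
  have hf0 : ∀ t, ∑ b, F t b = 0 := fun t => by rw [Fintype.sum_bool, hF0]
  have hnR : (0 : ℝ) < n := by exact_mod_cast hnpos
  have hsum : ∑ _t : β, (K / 2) ^ 2 = n * (K / 2) ^ 2 := by
    rw [sum_const, card_univ, hn, nsmul_eq_mul]
  have hS : 0 < ∑ _t : β, (K / 2) ^ 2 := by
    rw [hsum]; positivity
  have ht : 0 ≤ δ * K * n := by positivity
  have hH := Literature.Probability.Moments.hoeffding_count_pi (κ := fun _ : β => Bool) F
    (fun _ => K / 2) hf0 hFK ht hS
  have hprod : ∏ _t : β, (Fintype.card Bool : ℝ) = 2 ^ n := by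
    rw [prod_const, card_univ, hn, Fintype.card_bool]; norm_num
  have hexp : Real.exp (-((δ * K * n) ^ 2 / (2 * ∑ _t : β, (K / 2) ^ 2))) =
      Real.exp (-(2 * δ ^ 2 * n)) := by
    rw [hsum]
    congr 2
    field_simp
  rw [hexp, hprod] at hH
  exact hH

set_option linter.dupNamespace false in -- deliberate `Summit.<S>.<P>` duplicate
/-- **stub_balancedSplit** (EXCHANGEABILITY: Hoeffding for half-sampling + union bound, existence
form). For a finite family `(f_i)_{i ∈ ι}` of test functions on `T` with `0 ≤ f_i ≤ M_i`, if
`2|ι|·e^{-2δ²|T|} < 1` then ONE subset `T₁ ⊆ T` balances them all: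
`|Σ_{T₁} f_i − ½Σ_T f_i| < δ·M_i·|T|` for every `i`. (A subset is a point of `↥T → Bool`;
`Σ_{T₁} f_i − ½Σ_T f_i = Σ_t ±f_i(t)/2`; each of the `2|ι|` one-sided Hoeffding tails at
`λ = δM_i|T|` has `≤ e^{-2δ²|T|}·2^{|T|}` points, so by the union bound a good point exists;
`T = ∅` forces `ι = ∅`.) [folklore] -/
theorem stub_balancedSplit {α ι : Type*} [DecidableEq α] [Fintype ι] (T : Finset α)
    (f : ι → α → ℝ) (M : ι → ℝ) (δ : ℝ) (hδ : 0 < δ) (hM : ∀ i, 0 < M i)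
    (hf : ∀ i, ∀ t ∈ T, 0 ≤ f i t ∧ f i t ≤ M i)
    (hι : 2 * (Fintype.card ι : ℝ) * Real.exp (-(2 * δ ^ 2 * T.card)) < 1) :
    ∃ T₁ ⊆ T, ∀ i, |∑ t ∈ T₁, f i t - (∑ t ∈ T, f i t) / 2| < δ * M i * T.card := by
  rcases T.eq_empty_or_nonempty with rfl | hT
  · -- `T = ∅`: `hι` reads `2|ι| < 1`, so `ι` is empty and `T₁ = ∅` works vacuously
    refine ⟨∅, Finset.empty_subset _, fun i => ?_⟩
    exfalso
    have h1 : (1 : ℝ) ≤ Fintype.card ι := by exact_mod_cast Fintype.card_pos_iff.2 ⟨i⟩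
    simp only [Finset.card_empty, Nat.cast_zero, mul_zero, neg_zero, Real.exp_zero,
      mul_one] at hι
    linarith
  -- main case: `T ≠ ∅`; coordinates `↥T`, product space `↥T → Bool`
  have hcardT : Fintype.card T = T.card := Fintype.card_coe T
  have hTpos : 0 < T.card := hT.card_pos
  set E : ℝ := Real.exp (-(2 * δ ^ 2 * T.card)) with hE
  -- the signed half deviation of coordinate `t` for test function `i`
  obtain ⟨D, hD⟩ : ∃ D : ι → T → Bool → ℝ,
      ∀ i t b, D i t b = if b then f i t / 2 else -(f i t / 2) := ⟨_, fun _ _ _ => rfl⟩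
  have hDK : ∀ i (t : T) (b : Bool), |D i t b| ≤ M i / 2 := fun i t b => by
    obtain ⟨h0, hle⟩ := hf i t t.2
    rw [hD]
    cases b
    · rw [if_neg Bool.false_ne_true, abs_neg, abs_of_nonneg (by linarith)]; linarith
    · rw [if_pos rfl, abs_of_nonneg (by linarith)]; linarith
  have hD0 : ∀ i (t : T), D i t true + D i t false = 0 := fun i t => by
    rw [hD, hD, if_pos rfl, if_neg Bool.false_ne_true]; ring
  -- the two one-sided bad events for test function `i`
  obtain ⟨bad, hbad⟩ : ∃ bad : ι → Finset (T → Bool), ∀ i, bad i =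
      (univ.filter fun y : T → Bool => δ * M i * T.card ≤ ∑ t, D i t (y t)) ∪
        (univ.filter fun y : T → Bool => δ * M i * T.card ≤ ∑ t, -D i t (y t)) :=
    ⟨_, fun _ => rfl⟩
  have hbadcard : ∀ i, ((bad i).card : ℝ) ≤ E * 2 ^ T.card + E * 2 ^ T.card := fun i => by
    have hP := card_filter_signedHalfSum_le (D i) hcardT hTpos hδ.le (hM i) (hD0 i) (hDK i)
    have hN := card_filter_signedHalfSum_le (fun t b => -D i t b) hcardT hTpos hδ.le (hM i)
      (fun t => by have := hD0 i t; linarith) (fun t b => by rw [abs_neg]; exact hDK i t b)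
    rw [hbad]
    calc (((univ.filter fun y : T → Bool => δ * M i * T.card ≤ ∑ t, D i t (y t)) ∪
          (univ.filter fun y : T → Bool => δ * M i * T.card ≤ ∑ t, -D i t (y t))).card : ℝ)
        ≤ ((univ.filter fun y : T → Bool => δ * M i * T.card ≤ ∑ t, D i t (y t)).card : ℝ) +
          ((univ.filter fun y : T → Bool => δ * M i * T.card ≤ ∑ t, -D i t (y t)).card : ℝ) := by
          exact_mod_cast card_union_le _ _
      _ ≤ E * 2 ^ T.card + E * 2 ^ T.card := add_le_add hP hN
  -- union bound: the bad points are fewer than all `2^{|T|}` points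
  have hlt : ((univ.biUnion bad).card : ℝ) < ((univ : Finset (T → Bool)).card : ℝ) := by
    calc ((univ.biUnion bad).card : ℝ) ≤ ∑ i, ((bad i).card : ℝ) := by
          exact_mod_cast card_biUnion_le
      _ ≤ ∑ _i, (E * 2 ^ T.card + E * 2 ^ T.card) := sum_le_sum fun i _ => hbadcard i
      _ = 2 * (Fintype.card ι : ℝ) * E * 2 ^ T.card := by
          rw [sum_const, card_univ, nsmul_eq_mul]; ring
      _ < 1 * 2 ^ T.card := mul_lt_mul_of_pos_right hι (by positivity)
      _ = ((univ : Finset (T → Bool)).card : ℝ) := by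
          rw [one_mul, card_univ, Fintype.card_fun, Fintype.card_bool, hcardT]; norm_num
  obtain ⟨y, -, hy⟩ := exists_mem_notMem_of_card_lt_card (by exact_mod_cast hlt)
  -- the good point `y`: `T₁ := {t ∈ T | y t}`
  refine ⟨(univ.filter fun t : T => y t = true).map (Function.Embedding.subtype _), ?_,
    fun i => ?_⟩
  · intro a ha
    rw [mem_map] at ha
    obtain ⟨t, -, rfl⟩ := ha
    exact t.2
  · have hyi : y ∉ bad i := fun h => hy (mem_biUnion.2 ⟨i, mem_univ _, h⟩)
    rw [hbad, mem_union, not_or] at hyi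
    have h1 : ∑ t, D i t (y t) < δ * M i * T.card :=
      not_le.1 fun h => hyi.1 (mem_filter.2 ⟨mem_univ _, h⟩)
    have h2 : ∑ t, -D i t (y t) < δ * M i * T.card :=
      not_le.1 fun h => hyi.2 (mem_filter.2 ⟨mem_univ _, h⟩)
    rw [sum_neg_distrib] at h2
    have hdev : ∑ t ∈ (univ.filter fun t : T => y t = true).map (Function.Embedding.subtype _),
        f i t - (∑ t ∈ T, f i t) / 2 = ∑ t, D i t (y t) := by
      rw [sum_map, sum_filter, ← Finset.sum_coe_sort T (f i), sum_div, ← sum_sub_distrib]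
      refine sum_congr rfl fun t _ => ?_
      rw [hD, Function.Embedding.coe_subtype]
      by_cases h : y t = true
      · rw [if_pos h, if_pos h]; ring
      · rw [if_neg h, if_neg h]; ring
    rw [hdev, abs_lt]
    exact ⟨by linarith, h1⟩

end Summit.MatrixMultiplication.MatrixMultiplication.Theorems.PolynomialSlack
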